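import Mathlib
import Summits.NavierStokesRegularity.NavierStokesRegularity.Theorems.SubcriticalEnvelopeForwardSourceTailEnvelopeKPPerm
import Summits.NavierStokesRegularity.NavierStokesRegularity.Theorems.SubOnsagerCeilingForwardTailCeilingKPDyadicLowRange
import HarnessLib

/-!
# `SubcriticalEnvelope.ForwardSourceTailEnvelopeKP` (stmt-NavierStokesRegularity-27130) — the uniform KP
permutation-network rung on the LOW-WIDE range `ε₀ ∈ [9/16, 1]` (helper file, `--supports`;
consumer of LEAD SOC's RUNG 4, KEY-NS #146 (2))

ns-soc-p2 g4's RUNG 4 (`dyadicLowRange_shellBarrier`, `ε₀ ∈ [9/16, 31/50]`, shell ratios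
`b ∈ [25/16, 81/50]`, second one-cut three-window template; wrapper `dyadicLowRangeWide_shellBarrierAt`
on `[9/16, 1]`) extends the one-mode chain barrier below `b = 1.62`.  Through the ratio-agnostic
transfer `kpPerm_shellBound_of_chain` (p640129) every uniform KP permutation network
`kpPermTable σ c` (`c` constant on `σ`-orbits) inherits it verbatim:

* `kpPerm_shellBarrier_lowRange` — `ε₀ ∈ [9/16, 31/50]`, `θ = 101/200`, `D = 100`, `c ≥ 0`;
* `kpPermLowWide_shellBarrierAt : ∀ R, ∀ ε₀ ∈ [9/16, 1], ShellBarrierAt R ε₀ (kpPermTable σ c)` for every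
  `σ` and every orbit-constant `c` (glued at `31/50` with `kpPermWide_shellBarrierAt`; the orthant
  binder forces the signs), `kpPermLowWide_ceilingAt`;
* `forwardSourceTailEnvelopeKP_at_kpPermLow` (S = univ) and `…_sources` (S := S⁺ = {a : c a ≠ 0}) —
  the 27130 clause on this class and range.

So the 27130 rung inventory of record becomes {uniform KP permutation networks} × [9/16, 1]
(sibling census on 27130; not folded onto 27057's skeleton).

HONEST FRAMING: MODEL lattice statements (rung TL-M2Break); one architecture class, one ratio range;
the cruxes 27057/27130 are NOT proved; nothing here concerns the Navier–Stokes equations; NS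
regularity is NOT advanced.
-/

noncomputable section

-- the sub-problem namespace `NavierStokesRegularity.NavierStokesRegularity` is the tree's layout (D-0017)
set_option linter.dupNamespace false

namespace Summit.NavierStokesRegularity.NavierStokesRegularity.Theorems

open Set
open Literature.Analysis.FluidPDE.TaoCascade
open Summit.NavierStokesRegularity.NavierStokesRegularity.Theorems.SubOnsagerCeiling
open Summit.NavierStokesRegularity.NavierStokesRegularity.Theses

/-- **Uniform KP permutation networks, low range `ε₀ ∈ [9/16, 31/50]`**: the ν-uniform weighted
per-shell bound (`θ = 101/200`, `D = 100`), by the transfer applied to ns-soc-p2's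
`dyadicLowRange_shellBarrier` (BY NAME).  MODEL lattice statement. [this file] -/
theorem kpPerm_shellBarrier_lowRange {σ : Equiv.Perm (Fin 4)} {c : Fin 4 → ℝ} {ε₀ : ℝ}
    (hcyc : ∀ a, c (σ a) = c a) (hc : ∀ a, 0 ≤ c a) (hε : (9 : ℝ) / 16 ≤ ε₀)
    (hε1 : ε₀ ≤ (31 : ℝ) / 50) :
    ∀ ν : ℝ, 0 < ν → ∀ (X₀ : Fin 4 → ℝ) (s : ℝ), 0 < s → ∀ X : Fin 4 → ℤ → ℝ → ℝ,
      (∀ (i : Fin 4) (k : ℤ), X i k 0 = if k = 0 then X₀ i else 0) →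
      (∀ (i : Fin 4) (k : ℤ), k < 0 → ∀ t : ℝ, X i k t = 0) →
      (∃ M : ℝ, ∀ (t : ℝ) (i : Fin 4) (k : ℤ), (1 + (1 + ε₀) ^ ((10 : ℝ) * k)) * |X i k t| ≤ M) →
      (∀ (i : Fin 4) (k : ℤ), Continuous (X i k)) →
      (∀ (i : Fin 4) (k : ℤ), ∀ t ∈ Set.Icc (0 : ℝ) s, HasDerivWithinAt (X i k)
        (quadTerm ε₀ (kpPermTable σ c) X i k t - ν * (1 + ε₀) ^ ((2 : ℝ) * k) * X i k t)
        (Set.Icc (0 : ℝ) s) t) →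
      (∀ t ∈ Set.Icc (0 : ℝ) s, ∀ (i : Fin 4) (k : ℤ), 1 ≤ k → 0 ≤ X i k t) →
      ∀ t ∈ Set.Icc (0 : ℝ) s, ∀ (i : Fin 4) (k : ℕ),
        (1 + ε₀) ^ (2 * (101 / 200) * (k : ℝ)) * ((1 / 2 : ℝ) * X i (k : ℤ) t ^ 2) ≤
          100 * (∑ j : Fin 4, (1 / 2 : ℝ) * X₀ j ^ 2) :=
  kpPerm_shellBound_of_chain hcyc (by linarith) (by norm_num) fun a ha =>
    dyadicLowRange_shellBarrier (lt_of_le_of_ne (hc a) (Ne.symm ha)) hε hε1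
      (α := fun i₁ i₂ i₃ μ => c a * dyadicTable i₁ i₂ i₃ μ) (fun _ _ _ _ => rfl)

/-- **The rung in the skeletons' binder shape on the LOW-WIDE range**:
`ShellBarrierAt R ε₀ (kpPermTable σ c)` for every spread `R`, every `ε₀ ∈ [9/16, 1]`, every `σ` and
EVERY orbit-constant `c` (split at `31/50` onto `kpPermWide_shellBarrierAt`; the orthant binder of
`ShellBarrierAt` forces `c ≥ 0`).  MODEL lattice statement. [this file] -/
theorem kpPermLowWide_shellBarrierAt {σ : Equiv.Perm (Fin 4)} {c : Fin 4 → ℝ}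
    (hcyc : ∀ a, c (σ a) = c a) :
    ∀ R : ℝ, ∀ ε₀ : ℝ, (9 : ℝ) / 16 ≤ ε₀ → ε₀ ≤ 1 → ShellBarrierAt R ε₀ (kpPermTable σ c) := by
  intro R ε₀ hε hε1
  rcases le_or_gt ε₀ ((31 : ℝ) / 50) with h | h
  · intro _hT hO
    have hc : ∀ a, 0 ≤ c a := kpPerm_coeff_nonneg_of_orthant hO
    exact ⟨101 / 200, by norm_num, 100, by norm_num, kpPerm_shellBarrier_lowRange hcyc hc hε h⟩
  · exact kpPermWide_shellBarrierAt hcyc R ε₀ (by linarith) hε1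

/-- **Tail ceiling for uniform KP permutation networks on `ε₀ ∈ [9/16, 1]`.** [this file] -/
theorem kpPermLowWide_ceilingAt {σ : Equiv.Perm (Fin 4)} {c : Fin 4 → ℝ} (hcyc : ∀ a, c (σ a) = c a) :
    ∀ R : ℝ, ∀ ε₀ : ℝ, (9 : ℝ) / 16 ≤ ε₀ → ε₀ ≤ 1 → CeilingAt R ε₀ (kpPermTable σ c) := by
  intro R ε₀ hε hε1
  exact subOnsagerCeiling_ceilingAt_of_shellBarrierAt (by linarith)
    (kpPermLowWide_shellBarrierAt hcyc R ε₀ hε hε1)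

/-- **The 27130 clause on the uniform KP permutation networks at every `ε₀ ∈ [9/16, 1]`** (`S = univ`,
`η = 1/100`, window constant uniform in `T` and `ν`).  MODEL lattice statement; the crux 27130 is NOT
proved (one architecture class, one ratio range). [this file] -/
theorem forwardSourceTailEnvelopeKP_at_kpPermLow {σ : Equiv.Perm (Fin 4)} {c : Fin 4 → ℝ}
    (hcyc : ∀ a, c (σ a) = c a) :
    ∀ R : ℝ, 1 ≤ R → ∀ ε₀ : ℝ, (9 : ℝ) / 16 ≤ ε₀ → ε₀ ≤ 1 →
      InTableClass R (kpPermTable σ c) →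
      (∀ (Y : Fin 4 → ℤ → ℝ → ℝ) (τ : ℝ), (∀ (j : Fin 4) (k : ℤ), 1 ≤ k → 0 ≤ Y j k τ) →
        ∀ δ : ℝ, 0 < δ → ∀ (i : Fin 4) (n : ℤ), 1 ≤ n → Y i n τ = 0 →
        0 ≤ quadTerm δ (kpPermTable σ c) Y i n τ) →
      (∀ a b i : Fin 4, a ≠ b → kpPermTable σ c a b i (0, 0, 1) = 0) →
      ∃ S : Finset (Fin 4), (∀ i, i ∉ S → ∀ j l : Fin 4, kpPermTable σ c i j l (0, 0, 1) = 0) ∧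
      ∀ X₀ : Fin 4 → ℝ, ∃ η : ℝ, 0 < η ∧ ∀ T : ℝ, 0 < T → ∃ C : ℝ, ∀ ν : ℝ, 0 < ν →
      ∀ s ∈ Set.Ioc (0 : ℝ) T, ∀ X : Fin 4 → ℤ → ℝ → ℝ,
      (∀ i k, X i k 0 = if k = 0 then X₀ i else 0) →
      (∀ i k, k < 0 → ∀ t, X i k t = 0) →
      (∃ M : ℝ, ∀ (t : ℝ) (i : Fin 4) (k : ℤ), (1 + (1 + ε₀) ^ ((10 : ℝ) * k)) * |X i k t| ≤ M) →
      (∀ i k, Continuous (X i k)) →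
      (∀ i k, ∀ t ∈ Set.Icc (0 : ℝ) s, HasDerivWithinAt (X i k)
        (quadTerm ε₀ (kpPermTable σ c) X i k t - ν * (1 + ε₀) ^ ((2 : ℝ) * k) * X i k t)
        (Set.Icc 0 s) t) →
      ∀ n N : ℕ, n ≤ N → ∀ t ∈ Set.Icc (0 : ℝ) s,
        ∑ k ∈ Finset.Icc n N, ∑ i ∈ S, (1 / 2) * X i (k : ℤ) t ^ 2 ≤
          C * (1 + ε₀) ^ (-((1 + η) * (n : ℝ))) := by
  intro R _hR ε₀ hε hε1 hα hK _hdiag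
  have hε0 : 0 < ε₀ := by linarith
  obtain ⟨η, hη, C, _hC0, H⟩ :=
    viscousTailEnvelopeOrthant_uniform_of_ceilingAt hε0 hα hK (kpPermLowWide_ceilingAt hcyc R ε₀ hε hε1)
  refine ⟨Finset.univ, fun i hi => absurd (Finset.mem_univ i) hi, fun X₀ =>
    ⟨η, hη, fun T _hT => ⟨C * (∑ i : Fin 4, (1 / 2 : ℝ) * X₀ i ^ 2),
      fun ν hν s hs X hinit hlow hbd hcont hder n N hnN t ht => ?_⟩⟩⟩
  exact H ν hν X₀ s hs.1 X hinit hlow hbd hcont hder n N hnN t ht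

/-- **The 27130 clause on `[9/16, 1]` with the CANONICAL mode set `S := S⁺(α) = {a : c a ≠ 0}`.**
MODEL lattice statement. [this file] -/
theorem forwardSourceTailEnvelopeKP_at_kpPermLow_sources {σ : Equiv.Perm (Fin 4)} {c : Fin 4 → ℝ}
    (hcyc : ∀ a, c (σ a) = c a) :
    ∀ R : ℝ, 1 ≤ R → ∀ ε₀ : ℝ, (9 : ℝ) / 16 ≤ ε₀ → ε₀ ≤ 1 →
      InTableClass R (kpPermTable σ c) →
      (∀ (Y : Fin 4 → ℤ → ℝ → ℝ) (τ : ℝ), (∀ (j : Fin 4) (k : ℤ), 1 ≤ k → 0 ≤ Y j k τ) →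
        ∀ δ : ℝ, 0 < δ → ∀ (i : Fin 4) (n : ℤ), 1 ≤ n → Y i n τ = 0 →
        0 ≤ quadTerm δ (kpPermTable σ c) Y i n τ) →
      (∀ i, i ∉ (Finset.univ.filter fun a : Fin 4 => c a ≠ 0) →
        ∀ j l : Fin 4, kpPermTable σ c i j l (0, 0, 1) = 0) ∧
      ∀ X₀ : Fin 4 → ℝ, ∃ η : ℝ, 0 < η ∧ ∀ T : ℝ, 0 < T → ∃ C : ℝ, ∀ ν : ℝ, 0 < ν →
      ∀ s ∈ Set.Ioc (0 : ℝ) T, ∀ X : Fin 4 → ℤ → ℝ → ℝ,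
      (∀ i k, X i k 0 = if k = 0 then X₀ i else 0) →
      (∀ i k, k < 0 → ∀ t, X i k t = 0) →
      (∃ M : ℝ, ∀ (t : ℝ) (i : Fin 4) (k : ℤ), (1 + (1 + ε₀) ^ ((10 : ℝ) * k)) * |X i k t| ≤ M) →
      (∀ i k, Continuous (X i k)) →
      (∀ i k, ∀ t ∈ Set.Icc (0 : ℝ) s, HasDerivWithinAt (X i k)
        (quadTerm ε₀ (kpPermTable σ c) X i k t - ν * (1 + ε₀) ^ ((2 : ℝ) * k) * X i k t)
        (Set.Icc 0 s) t) →
      ∀ n N : ℕ, n ≤ N → ∀ t ∈ Set.Icc (0 : ℝ) s,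
        ∑ k ∈ Finset.Icc n N, ∑ i ∈ (Finset.univ.filter fun a : Fin 4 => c a ≠ 0),
          (1 / 2) * X i (k : ℤ) t ^ 2 ≤ C * (1 + ε₀) ^ (-((1 + η) * (n : ℝ))) := by
  intro R _hR ε₀ hε hε1 hα hK
  refine ⟨kpPermTable_sourceComplete σ c, fun X₀ => ?_⟩
  have hε0 : 0 < ε₀ := by linarith
  obtain ⟨η, hη, C, _hC0, H⟩ :=
    viscousTailEnvelopeOrthant_uniform_of_ceilingAt hε0 hα hK (kpPermLowWide_ceilingAt hcyc R ε₀ hε hε1)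
  refine ⟨η, hη, fun T _hT => ⟨C * (∑ i : Fin 4, (1 / 2 : ℝ) * X₀ i ^ 2),
    fun ν hν s hs X hinit hlow hbd hcont hder n N hnN t ht => ?_⟩⟩
  have hfull := H ν hν X₀ s hs.1 X hinit hlow hbd hcont hder n N hnN t ht
  refine le_trans (Finset.sum_le_sum fun k _ => ?_) hfull
  exact Finset.sum_le_univ_sum_of_nonneg fun i => by positivity

end Summit.NavierStokesRegularity.NavierStokesRegularity.Theorems

end
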